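import Summits.Ventures.AbcSig.Rows.Bridge
import Summits.Ventures.AbcSig.Rows.C2aL163A0S
import Summits.Ventures.AbcSig.Rows.C2aL163A0SAB

/-!
# Venture AbcSig — CELL `C2aL163A0S`: the census statement `Rows.C2aCellRed 163 (fun a => a = 0) {11}` from the two row theorems

HONEST FRAMING. COMPUTATION cell `pub-abcsig`; CONDITIONAL theorem; no claim on ABC or any summit. Hypotheses exactly as in
`Rows/C2aL163A0S.lean` and `Rows/C2aL163A0SAB.lean`: `BS04Package` (CITED), `DataComplete` / `RefinesCPSymAll` (COMPUTED, certified level files;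
norm-form certificates), `EisPackage` (CITED) + `Refines` (COMPUTED) for the kernel M6 discharges, and the rows' per-orbit CITED exclusions universally quantified in the exponent
(shared by both distributions (a = 0: the second is the first with x, y swapped)). Conclusion = p1's census predicate (`Rows/Statements.lean`) with the residual of the row of
record `census/rows/C2a/C2a-l163-a0.md` (sha16 `94f777c7d089aa73`): all four coprime distributions `A·B = 2^0·163^m`, reduced exponents.
GENERATED by p-lean g5 `gen5/c2arow4.py` (pattern of `Rows/C2aL277A0XCell.lean`).
-/

namespace Summit.Ventures.AbcSig

/-- Cell `C2aL163A0S`: `Rows.C2aCellRed 163 (fun a => a = 0) {11}` under the rows' hypotheses. -/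
theorem xcell_C2aL163A0S (M : NewformModel) (hP : M.BS04Package)
    (hE : M.EisPackage)
    (hR_orbit_326_5 : M.Refines 326 orbit_326_5 m6X_326_5)
    (hRB_orbit_326_4 : ∀ f : M.Form 326, M.Matches f orbit_326_4 → M.Matches f rb_326_4)
    (hD5216 : M.DataComplete 5216 level5216Orbits)
    (hD326 : M.DataComplete 326 level326Orbits)
    (hX_orbit_5216_5 : ∀ n m : ℕ, n ∈ ([41] : List ℕ) → M.Excludes 5216 orbit_5216_5 (famB (2 ^ 0 * 163 ^ m) n (fun _ _ => True)))
    (hX_orbit_5216_6 : ∀ n m : ℕ, n ∈ ([41] : List ℕ) → M.Excludes 5216 orbit_5216_6 (famB (2 ^ 0 * 163 ^ m) n (fun _ _ => True))) :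
    Rows.C2aCellRed 163 (fun a => a = 0) {11} :=
  C2aCellRed_of_rows 163 (by norm_num) (by norm_num) _ _
    (fun n hn h11 hnℓ hR a m (ha : a = 0) han hm hmn x y z h1 h2 => by
      subst ha
      exact xrow_C2aL163A0S M hP hE hR_orbit_326_5 hRB_orbit_326_4 hD5216 hD326 n hn h11 hnℓ (by simpa using hR) m hm hmn (hX_orbit_5216_5 n m) (hX_orbit_5216_6 n m) x y z h1 h2)
    (fun n hn h11 hnℓ hR a m (ha : a = 0) han hm hmn x y z h1 h2 => by
      subst ha
      exact xrow_C2aL163A0SAB M hP hE hR_orbit_326_5 hRB_orbit_326_4 hD5216 hD326 n hn h11 hnℓ (by simpa using hR) m hm hmn (hX_orbit_5216_5 n m) (hX_orbit_5216_6 n m) x y z h1 h2)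

end Summit.Ventures.AbcSig
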